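import Summits.HodgeConjecture.CorCM.GaloisTwentyFourDegenerateModels
import Mathlib.GroupTheory.SpecificGroups.Quaternion
import HarnessLib

/-!
# Annihilator certificates: an integer weight on a group model certifies a primitive DEGENERATE CM type

COR-CM (cell `pub-hodgecm2`), binder seat b04 (gen 24), count-neutral claim REAL-FACTOR — certificate toolbox for the
ARITHMETIC frontier.  HC_CM is NOT proved here; KERNEL ONLY: theorems; no definition, no named fact, no `sorry`.

Gen 20's certificate format (`GaloisModels.exists_simple_degenerate_of_model_balanced`) certifies degeneracy by a BALANCED finite
set moved by `c`, i.e. by a `{0, ±1}`-valued antisymmetric weight annihilated by all right translates of the type.  By gen 20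
part I (`GaloisRank.isNondegenerate_iff_forall_annihilator`, Hazama/Kubota) a CM type `S` read on a model `G₀` is nondegenerate
iff EVERY `c₀`-antisymmetric rational weight `b` with `Σ_{s ∈ S} b(s g) = 0` for all `g` vanishes; so ANY non-zero integer weight
of this kind is a certificate of degeneracy — needed when the annihilator lattice has no `±1`-vector (arithmetic degeneracies: a
singular Fourier block of an odd irreducible representation, e.g. gen 23's computed-only order-32 rows, the `Q₈ × C_p` family).

* §1 `exists_isPrimitive_not_isNondegenerate_of_model_annihilator`, `exists_simple_degenerate_of_model_annihilator`: `e : Gal(K/ℚ)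
  ≃* G₀`, `c₀ = e(c)`; a CM set `T₀` with trivial left stabiliser; `b : G₀ → ℤ` with `b(c₀ y) = −b(y)`, `Σ_{s∈T₀} b(s g) = 0` for
  all `g`, `b ≠ 0` ⟹ a PRIMITIVE DEGENERATE CM type, realised by a simple CM abelian variety of dimension `|G₀|/2` with an
  exceptional Hodge class on some power.
* §2 example: the `Q₈ × C₅` type of `CorCM/GaloisQuaternionCyclicFiveDegenerate` with an integer weight of values `0, ±1, …, ±5`
  from its annihilator lattice (`scratch-g24/g24f.py`, kernel dimension `8`), by `decide`.

References: Kubota (1965) §2 [cite: Kubota1965]; Gordon (1999), §9.3, Thm. 6.4 [cite: Gordon1999HodgeAVSurvey]; Shimura (1998),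
§6.2 Thm. 3, §8.2 Prop. 26 [cite: Shimura1998].
-/

noncomputable section

open CategoryTheory CategoryTheory.Limits NumberField
open scoped BigOperators

namespace Summit.HodgeConjecture.CorCM.GaloisModels

open Literature.NumberTheory.ComplexMultiplication
open Literature.AlgebraicGeometry.Motives (AbelianVariety CMType)
open Literature.AlgebraicGeometry.HodgeTheory
open Literature.AlgebraicGeometry.ComplexMultiplication (IsCMTypeRealisation)
open Literature.AlgebraicGeometry.Pohlmann1968
open Literature.Barriers.HodgeConjecture (divisorClassesSpan)
open Summit.HodgeConjecture.CorCM.GaloisRank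
open Summit.HodgeConjecture.CorCM.AbelianSixteen (exists_simple_realisation_of_isPrimitive)

variable {K : Type} [Field K] [NumberField K] [IsCMField K]

/-! ## §1 The annihilator certificate format -/

/-- **Annihilator certificate ⟹ primitive degenerate CM type.**  `e : Gal(K/ℚ) ≃* G₀`, `c₀ = e(c)`; `T₀ ⊆ G₀` a CM set with
trivial left stabiliser; `b : G₀ → ℤ` antisymmetric (`b (c₀ y) = -b y`), annihilated by all right translates of `T₀`
(`Σ_{s∈T₀} b (s g) = 0`) and non-zero ⟹ `K` has a PRIMITIVE DEGENERATE CM type. [cite: Kubota1965, §2]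
[cite: Gordon1999HodgeAVSurvey, §9.3] [cite: Shimura1998, §8.2 Prop. 26] -/
theorem exists_isPrimitive_not_isNondegenerate_of_model_annihilator [IsGalois ℚ K] {G₀ : Type*} [Group G₀]
    [Fintype G₀] [DecidableEq G₀] (e : (K ≃ₐ[ℚ] K) ≃* G₀) (c₀ : G₀)
    (hc : e ((IsCMField.complexConj K).restrictScalars ℚ) = c₀) (T₀ : Finset G₀)
    (hcm : ∀ x : G₀, x ∈ T₀ ↔ c₀ * x ∉ T₀) (hprim : ∀ v : G₀, v ≠ 1 → ∃ w : G₀, ¬ (w ∈ T₀ ↔ v * w ∈ T₀))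
    (b : G₀ → ℤ) (hanti : ∀ y, b (c₀ * y) = -b y) (hann : ∀ g : G₀, ∑ s ∈ T₀, b (s * g) = 0) (hb : ∃ y, b y ≠ 0)
    (φ₀ : K →+* ℂ) : ∃ Φ : CMType K, IsPrimitive (ℂ ≃+* ℂ) Φ.1 φ₀ ∧ ¬ IsNondegenerate Φ := by
  classical
  obtain ⟨Φ, hprimΦ, hread⟩ := GaloisTable.exists_isPrimitive_of_tableModel (K := K) (X := G₀)
    (fun y z => y * z) e.toEquiv (fun _ _ => map_mul e _ _) c₀ hc 1 (map_one e) T₀ hcm hprim φ₀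
  refine ⟨Φ, hprimΦ, fun hnd => ?_⟩
  obtain ⟨y₀, hy₀⟩ := hb
  have hS : ∀ y : G₀, y ∈ T₀ ↔ embOf φ₀ (e.symm y) ∈ Φ.1 := fun y => hread y
  have hzero := (isNondegenerate_iff_forall_annihilator e hc Φ φ₀ T₀ hS).1 hnd (fun y => (b y : ℚ))
    (fun y => by rw [hanti]; push_cast; ring) (fun g => by exact_mod_cast hann g)
  have := congrFun hzero y₀
  simp only [Pi.zero_apply, Int.cast_eq_zero] at this
  exact hy₀ this

/-- **… realised: a SIMPLE DEGENERATE CM abelian variety of dimension `|G₀|/2`** with an exceptional Hodge class on some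
power. [cite: Shimura1998, §6.2 Thm. 3 and §8.2 Prop. 26] [cite: Gordon1999HodgeAVSurvey, Thm. 6.4] -/
theorem exists_simple_degenerate_of_model_annihilator [IsGalois ℚ K] {G₀ : Type*} [Group G₀] [Fintype G₀]
    [DecidableEq G₀] (e : (K ≃ₐ[ℚ] K) ≃* G₀) (c₀ : G₀) (hc : e ((IsCMField.complexConj K).restrictScalars ℚ) = c₀)
    (T₀ : Finset G₀) (hcm : ∀ x : G₀, x ∈ T₀ ↔ c₀ * x ∉ T₀)
    (hprim : ∀ v : G₀, v ≠ 1 → ∃ w : G₀, ¬ (w ∈ T₀ ↔ v * w ∈ T₀)) (b : G₀ → ℤ)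
    (hanti : ∀ y, b (c₀ * y) = -b y) (hann : ∀ g : G₀, ∑ s ∈ T₀, b (s * g) = 0) (hb : ∃ y, b y ≠ 0) :
    ∃ (Φ : CMType K) (φ₀ : K →+* ℂ) (A : AbelianVariety ℂ) (ι : 𝓞 K →+* End A)
      (θ : K →+* Module.End ℂ (complexBetti A.X 1)),
      IsPrimitive (ℂ ≃+* ℂ) Φ.1 φ₀ ∧ ¬ IsNondegenerate Φ ∧ IsCMTypeRealisation Φ A ι θ ∧ A.IsSimple ∧
      A.dim = Fintype.card G₀ / 2 ∧
      ∃ n p : ℕ, ∃ x : complexBetti (⨁ fun _ : Fin n => A).X (2 * p), IsRationalClass x ∧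
        IsOfHodgeType (⨁ fun _ : Fin n => A).dim (⨁ fun _ : Fin n => A).X (2 * p) p p x ∧
        x ∉ divisorClassesSpan (⨁ fun _ : Fin n => A).X (⨁ fun _ : Fin n => A).dim p := by
  obtain ⟨φ₀⟩ := (inferInstance : Nonempty (K →+* ℂ))
  obtain ⟨Φ, hprimΦ, hdeg⟩ :=
    exists_isPrimitive_not_isNondegenerate_of_model_annihilator e c₀ hc T₀ hcm hprim b hanti hann hb φ₀
  obtain ⟨A, ι, θ, hA, hs, hdim⟩ := exists_simple_realisation_of_isPrimitive Φ φ₀ hprimΦ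
  refine ⟨Φ, φ₀, A, ι, θ, hprimΦ, hdeg, hA, hs, ?_, exists_exceptional_pow_of_not_isNondegenerate φ₀ hprimΦ hdeg hA⟩
  rw [hdim, card_model_eq_finrank e]

/-! ## §2 Example: the `Q₈ × C₅` type with an integer weight of values `0, ±1, …, ±5` -/

open QuaternionGroup in
/-- **`Gal(K/ℚ) ≅ Q₈ × C₅`, `c = (a², 1)`: a simple DEGENERATE CM 20-fold** — the type of
`CorCM/GaloisQuaternionCyclicFiveDegenerate`, here certified by the INTEGER annihilator weight `b` with
`b(a¹, j) = 1` (`j ≠ 3`), `b(a⁰, j) = 2` (`j ∈ {0,1,3}`), `b(a², j) = 3` (`j ∈ {2,4}`), `b(a³, 3) = 4`, `b(x, 1) = b(xa², 0) = 5`,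
antisymmetric under `a²`, zero on the other `x aⁱ`. [cite: Kubota1965, §2] [cite: Shimura1998, §6.2 Thm. 3 and §8.2 Prop. 26] -/
theorem exists_simple_degenerate_of_quaternion_cyclicFive_annihilator [IsGalois ℚ K]
    (e : (K ≃ₐ[ℚ] K) ≃* QuaternionGroup 2 × Multiplicative (ZMod 5))
    (hc : e ((IsCMField.complexConj K).restrictScalars ℚ) = (a 2, Multiplicative.ofAdd 0)) :
    ∃ (Φ : CMType K) (φ₀ : K →+* ℂ) (A : AbelianVariety ℂ) (ι : 𝓞 K →+* End A)
      (θ : K →+* Module.End ℂ (complexBetti A.X 1)),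
      IsPrimitive (ℂ ≃+* ℂ) Φ.1 φ₀ ∧ ¬ IsNondegenerate Φ ∧ IsCMTypeRealisation Φ A ι θ ∧ A.IsSimple ∧
      A.dim = 20 ∧
      ∃ n p : ℕ, ∃ x : complexBetti (⨁ fun _ : Fin n => A).X (2 * p), IsRationalClass x ∧
        IsOfHodgeType (⨁ fun _ : Fin n => A).dim (⨁ fun _ : Fin n => A).X (2 * p) p p x ∧
        x ∉ divisorClassesSpan (⨁ fun _ : Fin n => A).X (⨁ fun _ : Fin n => A).dim p := by
  have h := exists_simple_degenerate_of_model_annihilator e _ hc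
    {(a 0, Multiplicative.ofAdd 2), (a 0, Multiplicative.ofAdd 3), (a 0, Multiplicative.ofAdd 4),
      (a 1, Multiplicative.ofAdd 0), (a 1, Multiplicative.ofAdd 1), (a 1, Multiplicative.ofAdd 2),
      (a 1, Multiplicative.ofAdd 3), (a 2, Multiplicative.ofAdd 0), (a 2, Multiplicative.ofAdd 1),
      (a 3, Multiplicative.ofAdd 4), (xa 0, Multiplicative.ofAdd 1), (xa 1, Multiplicative.ofAdd 0),
      (xa 1, Multiplicative.ofAdd 4), (xa 2, Multiplicative.ofAdd 0), (xa 2, Multiplicative.ofAdd 2),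
      (xa 2, Multiplicative.ofAdd 3), (xa 2, Multiplicative.ofAdd 4), (xa 3, Multiplicative.ofAdd 1),
      (xa 3, Multiplicative.ofAdd 2), (xa 3, Multiplicative.ofAdd 3)}
    (by decide) (by decide)
    (fun y =>
      if y ∈ ({(a 1, Multiplicative.ofAdd 0), (a 1, Multiplicative.ofAdd 1), (a 1, Multiplicative.ofAdd 2),
          (a 1, Multiplicative.ofAdd 4)} : Finset (QuaternionGroup 2 × Multiplicative (ZMod 5))) then 1
      else if y ∈ ({(a 3, Multiplicative.ofAdd 0), (a 3, Multiplicative.ofAdd 1), (a 3, Multiplicative.ofAdd 2),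
          (a 3, Multiplicative.ofAdd 4)} : Finset (QuaternionGroup 2 × Multiplicative (ZMod 5))) then -1
      else if y ∈ ({(a 0, Multiplicative.ofAdd 0), (a 0, Multiplicative.ofAdd 1), (a 0, Multiplicative.ofAdd 3)} :
          Finset (QuaternionGroup 2 × Multiplicative (ZMod 5))) then 2
      else if y ∈ ({(a 2, Multiplicative.ofAdd 0), (a 2, Multiplicative.ofAdd 1), (a 2, Multiplicative.ofAdd 3)} :
          Finset (QuaternionGroup 2 × Multiplicative (ZMod 5))) then -2
      else if y ∈ ({(a 2, Multiplicative.ofAdd 2), (a 2, Multiplicative.ofAdd 4)} :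
          Finset (QuaternionGroup 2 × Multiplicative (ZMod 5))) then 3
      else if y ∈ ({(a 0, Multiplicative.ofAdd 2), (a 0, Multiplicative.ofAdd 4)} :
          Finset (QuaternionGroup 2 × Multiplicative (ZMod 5))) then -3
      else if y = (a 3, Multiplicative.ofAdd 3) then 4
      else if y = (a 1, Multiplicative.ofAdd 3) then -4
      else if y ∈ ({(xa 0, Multiplicative.ofAdd 1), (xa 2, Multiplicative.ofAdd 0)} :
          Finset (QuaternionGroup 2 × Multiplicative (ZMod 5))) then 5
      else if y ∈ ({(xa 0, Multiplicative.ofAdd 0), (xa 2, Multiplicative.ofAdd 1)} :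
          Finset (QuaternionGroup 2 × Multiplicative (ZMod 5))) then -5
      else 0)
    (by decide) (by decide) ⟨(a 3, Multiplicative.ofAdd 3), by decide⟩
  rwa [Fintype.card_prod, QuaternionGroup.card, Fintype.card_multiplicative, ZMod.card] at h

end Summit.HodgeConjecture.CorCM.GaloisModels

end
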